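import Summits.CriticalPhenomena.PercolationContinuityZ3.Theorems.Transplant.SkelPhiFaceTargetMM
import HarnessLib

/-!
# N1 ({±1} node), (F) inner route, part R5b-v′ (hp-8 g33): **THE TARGET TEST AS A CELL BOX** — the contact `c` is off the cube's transverse centre
# by up to `k_E ≈ 2r⊥ ≫ b₀`, so the symmetric footprint test `FootBox glo ghi gw` (transverse window centred at the contact's cell) cannot hold the
# arrival box; the target test must be the two-sided CELL BOX `FS_c w ∈ Icc LLO LHI` with `z_c + [LLO, LHI] ⊆ cen (x+du) ± (b₀ − 2)` coordinatewise.
builds on p205010 (kernel theorem, internal audit signed; external expert review pending) — nothing in this file uses p205010; no claim about the open node.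
Lane `prim-bschramm`, seat `prim-hp-8` (gen 33); helper file (`--supports stmt-CriticalPhenomena-4575 --as helper`).
* `Skelφ.cell_mem_Mb_of_cellBox`, **`mem_targetMM_of_cellBox`**.
[cite: KozmaNitzan2024, §4 p. 26 (M_v), p. 30 (Step III), Lemma 11 (p. 22)]
-/

noncomputable section

open scoped Classical

namespace Summit.CriticalPhenomena.PercolationContinuityZ3.Theorems.Transplant

namespace Skelφ

open Literature.Probability.Percolation Literature.Probability.LatticeModels KNCells
open Literature.Probability.Percolation.KozmaNitzan
open Literature.Probability.Percolation.KozmaNitzan.Cells (oth oth_ne sgOf sgOf_sign stepVec_apply_fst stepVec_apply_oth eq_oth_of_ne oth_oth)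
open Literature.Barriers.CriticalPhenomena (graphBall graphBall_mono)
open BoxProdZ2 (ConcRadiiG)

variable {V : Type} {G : SimpleGraph V} [G.LocallyFinite] {φ : V → Site 2}

omit [G.LocallyFinite] in
/-- The cell of a vertex whose base-`c` cell lies in `[LLO, LHI]`, with `z_c + [LLO, LHI] ⊆ cen (x+du) ± (b₀ − 2)` coordinatewise, is within `b₀ − 1` of
`cen (x+du)` (base change of the fine skeleton). [folklore] -/
theorem cell_mem_Mb_of_cellBox (P : PCells2) (t₀ c : V) (A n h vα vβ c₀ c₁ : ℤ) {D : ℤ} (hD : 0 < D) {x : Site 2} {du : MDir}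
    {b₀ : Fin 2 → ℕ} {LLO LHI : Site 2} {w : V} (hfb : fineSkel φ c A n h vα vβ c₀ c₁ (D / 2) (D / 2) D w ∈ Finset.Icc LLO LHI)
    (hlo : ∀ i, P.cen (x + stepVec du) i - b₀ i + 2 ≤ LLO i + fineSkel φ t₀ A n h vα vβ c₀ c₁ (D / 2) (D / 2) D c i)
    (hhi : ∀ i, LHI i + fineSkel φ t₀ A n h vα vβ c₀ c₁ (D / 2) (D / 2) D c i ≤ P.cen (x + stepVec du) i + b₀ i - 2) :
    ∀ i, |fineSkel φ t₀ A n h vα vβ c₀ c₁ (D / 2) (D / 2) D w i - P.cen (x + stepVec du) i| + 1 ≤ b₀ i := by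
  intro i
  have hbc := abs_le.1 (abs_fineSkel_base_change (φ := φ) t₀ c w A n h vα vβ c₀ c₁ hD i)
  rw [Finset.mem_Icc, Pi.le_def, Pi.le_def] at hfb
  have h1 := hfb.1 i
  have h2 := hfb.2 i
  have h3 := hlo i
  have h4 := hhi i
  have : |fineSkel φ t₀ A n h vα vβ c₀ c₁ (D / 2) (D / 2) D w i - P.cen (x + stepVec du) i| ≤ b₀ i - 1 := by
    rw [abs_le]; constructor <;> linarith
  linarith

/-- **CELL BOX ⟹ TARGET** for every vertex of the outer ball: near ones land in `M` (weak-step neighbour inside `Mb`), far ones in `RimG`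
(`1 ≤ L′ ≤ rM`). [cite: KozmaNitzan2024, §4 p. 26, p. 30 (Step III)] -/
theorem mem_targetMM_of_cellBox [DecidableEq V] {pr : FinePrm} {P : PCells2} {w₀ : V} {Λ : ConcRadiiG} {b₀ : Fin 2 → ℕ} (c : V) {a' : ℕ}
    {x : Site 2} {du : MDir} {L' : ℕ} (hL' : 1 ≤ L') (hrM : L' ≤ Λ.rM a' (x + stepVec du)) (hD : 0 < pr.D) (hlip : Lip G (pr.ψ φ w₀))
    (hws : WeakSteps G (pr.ψ φ w₀)) {LLO LHI : Site 2} {w : V} (hwB : w ∈ graphBall G w₀ (Λ.rE a' x du))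
    (hfb : pr.ψ φ c w ∈ Finset.Icc LLO LHI) (hlo : ∀ i, P.cen (x + stepVec du) i - b₀ i + 2 ≤ LLO i + pr.ψ φ w₀ c i)
    (hhi : ∀ i, LHI i + pr.ψ φ w₀ c i ≤ P.cen (x + stepVec du) i + b₀ i - 2) :
    w ∈ targetMM G φ pr P w₀ Λ b₀ a' x du L' := by
  have hin : ∀ i, |pr.ψ φ w₀ w i - P.cen (x + stepVec du) i| + 1 ≤ b₀ i :=
    cell_mem_Mb_of_cellBox (φ := φ) P w₀ c pr.A pr.n pr.h pr.vα pr.vβ pr.c₀ pr.c₁ hD hfb hlo hhi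
  have hMv : ∀ s : Site 2, (∀ i, |s i - P.cen (x + stepVec du) i| ≤ b₀ i) → s ∈ P.Mb b₀ (x + stepVec du) := fun s hs => by
    rw [PCells2.mem_Mb_iff]
    intro i
    have := abs_le.1 (hs i)
    constructor <;> linarith
  have hyM : pr.ψ φ w₀ w ∈ P.Mb b₀ (x + stepVec du) := hMv _ fun i => by have := hin i; linarith
  by_cases hnear : w ∈ graphBall G w₀ (Λ.rM a' (x + stepVec du) - L')
  · refine Finset.mem_union_left _ ?_
    simp only [cellGeomSG₂b_M]
    obtain ⟨m, hadj, -⟩ := hws w 0 1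
    have hmM : pr.ψ φ w₀ m ∈ P.Mb b₀ (x + stepVec du) := hMv _ fun i => by
      have h1 := hlip hadj i
      have h2 := hin i
      calc |pr.ψ φ w₀ m i - P.cen (x + stepVec du) i| = |(pr.ψ φ w₀ m i - pr.ψ φ w₀ w i) + (pr.ψ φ w₀ w i - P.cen (x + stepVec du) i)| := by
            ring_nf
        _ ≤ |pr.ψ φ w₀ m i - pr.ψ φ w₀ w i| + |pr.ψ φ w₀ w i - P.cen (x + stepVec du) i| := abs_add_le _ _
        _ ≤ _ := by rw [abs_sub_comm] at h1; linarith
    exact mem_VWin_of_adj_footprints hnear (by omega) hadj hyM hmM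
  · exact Finset.mem_union_right _ (Finset.mem_filter.2 ⟨(mem_Win G _).2 ⟨hwB, hyM⟩, hnear⟩)

end Skelφ

end Summit.CriticalPhenomena.PercolationContinuityZ3.Theorems.Transplant

end
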